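import Mathlib
import Literature.NumberTheory.Sieve.ChenTwinSieveLower
import HarnessLib

/-!
# Route ParityLeakOneFifth, crux `ParityLeakSieve` (stmt-Parity-18381), skeleton `birth`:
# the Type-I comparison of stub S1 — matching of the host and model main terms

Elementary tools for comparing, at one modulus `d`, the host main term `(x/φ(d))·V_sh(w)` with the
model main term `J_d·V_sh(z)·∏_{z≤p<w}(1 − 1/p)` (`J_d = ⌊(2x+2)/d⌋ − ⌊(x+2)/d⌋`):
* `inv_totient_sub_inv_le` — for `d` with at most two prime factors, all `≥ y ≥ 2`:
  `1/φ(d) − 1/d ≤ 3/((y−1)d)` and `1/φ(d) ≤ (1 + 3/(y−1))/d`;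
* `V_split`, `Vsh_split` — splitting `V(w)`, `V_sh(w)` at `z ≤ w` (via the tree's `Chen.prod_primesBelow_split`);
* `prod_sub_prod_le_sum` — `|∏(1 − 1/(p−1)) − ∏(1 − 1/p)| ≤ Σ (1/(p−1) − 1/p) ≤ 1/(⌈z⌉ − 1)` over the
  primes in `[z, w)`;
* `typeI_per_d_arith` — the triangle inequality assembling the bound for one `d`.
-/

namespace Summit.Parity.GeneralizedHardyLittlewood.Theorems.ParityLeakOneFifth

open Finset Real

/-! ### `1/φ(d)` versus `1/d` for rough `d` with few prime factors -/

/-- For `d ≠ 0` with at most two prime factors, all `≥ y ≥ 2` (`y` real):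
`d/φ(d) ≤ (1 + 1/(y−1))²`. -/
theorem div_totient_le {d : ℕ} {y : ℝ} (hd : d ≠ 0) (hy : 2 ≤ y)
    (hr : ∀ p ∈ d.primeFactors, y ≤ (p : ℝ)) (hk : #d.primeFactors ≤ 2) :
    (d : ℝ) / (Nat.totient d : ℝ) ≤ (1 + 1 / (y - 1)) ^ 2 := by
  have hφ0 : (0 : ℝ) < (Nat.totient d : ℝ) := by exact_mod_cast Nat.totient_pos.2 (Nat.pos_of_ne_zero hd)
  have key := Nat.totient_mul_prod_primeFactors d
  have keyR : (Nat.totient d : ℝ) * ∏ p ∈ d.primeFactors, (p : ℝ) =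
      (d : ℝ) * ∏ p ∈ d.primeFactors, ((p : ℝ) - 1) := by
    have h := congrArg (fun n : ℕ => (n : ℝ)) key
    simp only [Nat.cast_mul, Nat.cast_prod] at h
    rw [h]
    congr 1
    refine Finset.prod_congr rfl fun p hp => ?_
    rw [Nat.cast_sub (Nat.prime_of_mem_primeFactors hp).one_le, Nat.cast_one]
  -- `∏ p = ∏ (p-1) · ∏ p/(p-1)` and `p/(p-1) ≤ 1 + 1/(y-1)`
  have hP1 : 0 < ∏ p ∈ d.primeFactors, ((p : ℝ) - 1) :=
    Finset.prod_pos fun p hp => by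
      have := (Nat.prime_of_mem_primeFactors hp).two_le
      have : (2 : ℝ) ≤ p := by exact_mod_cast this
      linarith
  have hratio : (∏ p ∈ d.primeFactors, (p : ℝ)) / ∏ p ∈ d.primeFactors, ((p : ℝ) - 1) ≤
      (1 + 1 / (y - 1)) ^ 2 := by
    rw [← Finset.prod_div_distrib]
    have hle : ∀ p ∈ d.primeFactors, (p : ℝ) / ((p : ℝ) - 1) ≤ 1 + 1 / (y - 1) := by
      intro p hp
      have hyp := hr p hp
      have hp1 : 0 < (p : ℝ) - 1 := by linarith
      rw [div_le_iff₀ hp1]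
      have : 1 / (y - 1) * ((p : ℝ) - 1) ≥ 1 := by
        rw [ge_iff_le, one_div, inv_mul_eq_div, le_div_iff₀ (by linarith)]; linarith
      nlinarith
    have hge : ∀ p ∈ d.primeFactors, (1 : ℝ) ≤ (p : ℝ) / ((p : ℝ) - 1) := by
      intro p hp
      have hyp := hr p hp
      rw [le_div_iff₀ (by linarith)]; linarith
    have h1 : (1 : ℝ) ≤ 1 + 1 / (y - 1) := by
      have : 0 ≤ 1 / (y - 1) := by apply div_nonneg <;> linarith
      linarith
    calc ∏ p ∈ d.primeFactors, (p : ℝ) / ((p : ℝ) - 1)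
        ≤ ∏ _p ∈ d.primeFactors, (1 + 1 / (y - 1)) :=
          Finset.prod_le_prod (fun p hp => by linarith [hge p hp]) hle
      _ = (1 + 1 / (y - 1)) ^ #d.primeFactors := Finset.prod_const _
      _ ≤ (1 + 1 / (y - 1)) ^ 2 := pow_le_pow_right₀ h1 hk
  have e : (d : ℝ) / (Nat.totient d : ℝ) =
      (∏ p ∈ d.primeFactors, (p : ℝ)) / ∏ p ∈ d.primeFactors, ((p : ℝ) - 1) := by
    rw [div_eq_div_iff hφ0.ne' hP1.ne']
    linarith [keyR]
  rw [e]; exact hratio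

/-- For `d ≠ 0` with at most two prime factors, all `≥ y ≥ 2`:
`1/φ(d) − 1/d ≤ 3/((y−1) d)` and `1/φ(d) ≤ 4/d`. -/
theorem inv_totient_sub_inv_le {d : ℕ} {y : ℝ} (hd : d ≠ 0) (hy : 2 ≤ y)
    (hr : ∀ p ∈ d.primeFactors, y ≤ (p : ℝ)) (hk : #d.primeFactors ≤ 2) :
    1 / (Nat.totient d : ℝ) - 1 / (d : ℝ) ≤ 3 / ((y - 1) * d) ∧ 1 / (Nat.totient d : ℝ) ≤ 4 / (d : ℝ) := by
  have h := div_totient_le hd hy hr hk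
  have hd0 : (0 : ℝ) < d := by exact_mod_cast Nat.pos_of_ne_zero hd
  have hφ0 : (0 : ℝ) < (Nat.totient d : ℝ) := by exact_mod_cast Nat.totient_pos.2 (Nat.pos_of_ne_zero hd)
  have hy1 : 0 < y - 1 := by linarith
  have hu : 1 / (y - 1) ≤ 1 := by rw [div_le_one hy1]; linarith
  have hu0 : 0 ≤ 1 / (y - 1) := by positivity
  have hsq : (1 + 1 / (y - 1)) ^ 2 ≤ 1 + 3 / (y - 1) := by
    have : (1 / (y - 1)) ^ 2 ≤ 1 / (y - 1) := by nlinarith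
    have e : 3 / (y - 1) = 3 * (1 / (y - 1)) := by ring
    nlinarith
  have hmain : 1 / (Nat.totient d : ℝ) ≤ (1 + 3 / (y - 1)) / d := by
    rw [le_div_iff₀ hd0, one_div, ← div_eq_inv_mul]
    exact h.trans hsq
  constructor
  · have e : (1 + 3 / (y - 1)) / d - 1 / (d : ℝ) = 3 / ((y - 1) * d) := by
      field_simp
      ring
    linarith [e]
  · refine hmain.trans ?_
    have : 1 + 3 / (y - 1) ≤ 4 := by
      have : 3 / (y - 1) ≤ 3 := by rw [div_le_iff₀ hy1]; linarith
      linarith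
    exact div_le_div_of_nonneg_right this hd0.le

/-! ### Products over the primes below `w`, split at `z` -/

/-- `V(w) = V(z)·∏_{z≤p<w}(1 − 1/p)` for `z ≤ w`. -/
theorem V_split {z w : ℝ} (hzw : z ≤ w) :
    ∏ p ∈ (Finset.range ⌈w⌉₊).filter Nat.Prime, (1 - 1 / (p : ℝ)) =
      (∏ p ∈ (Finset.range ⌈z⌉₊).filter Nat.Prime, (1 - 1 / (p : ℝ))) *
        ∏ p ∈ (Nat.primesBelow ⌈w⌉₊).filter (fun p : ℕ => z ≤ (p : ℝ)), (1 - 1 / (p : ℝ)) :=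
  Literature.NumberTheory.Sieve.Chen.prod_primesBelow_split hzw _

/-- `V_sh(w) = V_sh(z)·∏_{z≤p<w}(1 − 1/(p−1))` for `2 < z ≤ w`. -/
theorem Vsh_split {z w : ℝ} (hz : 2 < z) (hzw : z ≤ w) :
    ∏ p ∈ (Finset.range ⌈w⌉₊).filter (fun p : ℕ => p.Prime ∧ p ≠ 2), (1 - 1 / ((p : ℝ) - 1)) =
      (∏ p ∈ (Finset.range ⌈z⌉₊).filter (fun p : ℕ => p.Prime ∧ p ≠ 2), (1 - 1 / ((p : ℝ) - 1))) *
        ∏ p ∈ (Nat.primesBelow ⌈w⌉₊).filter (fun p : ℕ => z ≤ (p : ℝ)), (1 - 1 / ((p : ℝ) - 1)) := by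
  have hodd : ∀ t : ℝ, (Finset.range ⌈t⌉₊).filter (fun p : ℕ => p.Prime ∧ p ≠ 2) =
      (Nat.primesBelow ⌈t⌉₊).filter (fun p : ℕ => p ≠ 2) := by
    intro t; ext p; simp [Nat.mem_primesBelow, Finset.mem_filter, and_assoc]
  rw [hodd w, hodd z, Finset.prod_filter, Finset.prod_filter, Literature.NumberTheory.Sieve.Chen.prod_primesBelow_split hzw]
  congr 1
  refine Finset.prod_congr rfl fun p hp => ?_
  rw [Finset.mem_filter] at hp
  have : p ≠ 2 := by
    intro h; subst h
    have : (2 : ℝ) < 2 := lt_of_lt_of_le hz (by exact_mod_cast hp.2)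
    linarith
  rw [if_pos this]

/-- For `0 ≤ a_i ≤ b_i ≤ 1`: `∏ b − ∏ a ≤ Σ (b_i − a_i)` and `∏ a ≤ ∏ b`. -/
theorem prod_sub_prod_le_sum {ι : Type*} (s : Finset ι) (a b : ι → ℝ)
    (ha : ∀ i ∈ s, 0 ≤ a i) (hab : ∀ i ∈ s, a i ≤ b i) (hb : ∀ i ∈ s, b i ≤ 1) :
    ∏ i ∈ s, b i - ∏ i ∈ s, a i ≤ ∑ i ∈ s, (b i - a i) := by
  classical
  induction s using Finset.induction_on with
  | empty => simp
  | insert j s hj ih =>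
    rw [Finset.prod_insert hj, Finset.prod_insert hj, Finset.sum_insert hj]
    have ha' : ∀ i ∈ s, 0 ≤ a i := fun i hi => ha i (Finset.mem_insert_of_mem hi)
    have hab' : ∀ i ∈ s, a i ≤ b i := fun i hi => hab i (Finset.mem_insert_of_mem hi)
    have hb' : ∀ i ∈ s, b i ≤ 1 := fun i hi => hb i (Finset.mem_insert_of_mem hi)
    have ih' := ih ha' hab' hb'
    have hPa : 0 ≤ ∏ i ∈ s, a i := Finset.prod_nonneg ha'
    have hPb1 : ∏ i ∈ s, b i ≤ 1 := Finset.prod_le_one (fun i hi => (ha' i hi).trans (hab' i hi)) hb'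
    have hPab : ∏ i ∈ s, a i ≤ ∏ i ∈ s, b i := Finset.prod_le_prod ha' hab'
    have haj := ha j (Finset.mem_insert_self j s)
    have habj := hab j (Finset.mem_insert_self j s)
    have hbj := hb j (Finset.mem_insert_self j s)
    -- `b_j B − a_j A = (b_j − a_j) B + a_j (B − A) ≤ (b_j − a_j) + (B − A)`
    have e : b j * ∏ i ∈ s, b i - a j * ∏ i ∈ s, a i =
        (b j - a j) * ∏ i ∈ s, b i + a j * (∏ i ∈ s, b i - ∏ i ∈ s, a i) := by ring
    rw [e]
    have h1 : (b j - a j) * ∏ i ∈ s, b i ≤ (b j - a j) := by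
      have := mul_le_mul_of_nonneg_left hPb1 (by linarith : 0 ≤ b j - a j); linarith
    have h2 : a j * (∏ i ∈ s, b i - ∏ i ∈ s, a i) ≤ ∏ i ∈ s, b i - ∏ i ∈ s, a i := by
      have := mul_le_mul_of_nonneg_right (habj.trans hbj) (by linarith : 0 ≤ ∏ i ∈ s, b i - ∏ i ∈ s, a i)
      linarith
    linarith

/-- The telescoping bound: `Σ_{p prime, z ≤ p < w} (1/(p−1) − 1/p) ≤ 1/(z − 1)` for `2 ≤ z`. -/
theorem sum_primes_inv_sub_inv_le {z w : ℝ} (hz : 2 ≤ z) :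
    ∑ p ∈ (Nat.primesBelow ⌈w⌉₊).filter (fun p : ℕ => z ≤ (p : ℝ)), (1 / ((p : ℝ) - 1) - 1 / (p : ℝ)) ≤
      1 / (z - 1) := by
  set a : ℕ := ⌈z⌉₊ with ha
  have ha2 : 2 ≤ a := by
    have : 1 < a := by rw [ha]; exact Nat.lt_ceil.2 (by push_cast; linarith)
    omega
  -- dominate by the sum over the integers `n ∈ [a, ⌈w⌉)`
  have hsub : (Nat.primesBelow ⌈w⌉₊).filter (fun p : ℕ => z ≤ (p : ℝ)) ⊆ Finset.Ico a ⌈w⌉₊ := by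
    intro p hp
    rw [Finset.mem_filter, Nat.mem_primesBelow] at hp
    rw [Finset.mem_Ico]
    exact ⟨Nat.ceil_le.2 hp.2, hp.1.1⟩
  have hnn : ∀ n ∈ Finset.Ico a ⌈w⌉₊, 0 ≤ 1 / ((n : ℝ) - 1) - 1 / (n : ℝ) := by
    intro n hn
    rw [Finset.mem_Ico] at hn
    have h2 : (2 : ℝ) ≤ n := by exact_mod_cast (ha2.trans hn.1)
    rw [sub_nonneg]
    exact one_div_le_one_div_of_le (by linarith) (by linarith)
  refine (Finset.sum_le_sum_of_subset_of_nonneg hsub fun n hn _ => hnn n hn).trans ?_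
  -- telescoping over `Ico a b`
  have htel : ∀ b : ℕ, a ≤ b → ∑ n ∈ Finset.Ico a b, (1 / ((n : ℝ) - 1) - 1 / (n : ℝ)) =
      1 / ((a : ℝ) - 1) - 1 / ((b : ℝ) - 1) := by
    intro b hb
    induction b, hb using Nat.le_induction with
    | base => simp
    | succ b hab ih =>
      rw [Finset.sum_Ico_succ_top hab, ih]
      push_cast
      ring
  by_cases hw : a ≤ ⌈w⌉₊
  · rw [htel _ hw]
    have h1 : 1 / ((a : ℝ) - 1) ≤ 1 / (z - 1) := by
      apply one_div_le_one_div_of_le (by linarith)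
      have := Nat.le_ceil z; rw [← ha] at this; linarith
    have h2 : 0 ≤ 1 / (((⌈w⌉₊ : ℕ) : ℝ) - 1) := by
      have : (2 : ℝ) ≤ ((⌈w⌉₊ : ℕ) : ℝ) := by exact_mod_cast ha2.trans hw
      apply div_nonneg zero_le_one; linarith
    linarith
  · rw [not_le] at hw
    rw [Finset.Ico_eq_empty (by omega), Finset.sum_empty]
    apply div_nonneg zero_le_one; linarith

/-- `|∏_{z≤p<w}(1 − 1/(p−1)) − ∏_{z≤p<w}(1 − 1/p)| ≤ 1/(z−1)` for `2 ≤ z`. -/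
theorem abs_prod_sub_prod_le {z w : ℝ} (hz : 2 ≤ z) :
    |(∏ p ∈ (Nat.primesBelow ⌈w⌉₊).filter (fun p : ℕ => z ≤ (p : ℝ)), (1 - 1 / ((p : ℝ) - 1))) -
        ∏ p ∈ (Nat.primesBelow ⌈w⌉₊).filter (fun p : ℕ => z ≤ (p : ℝ)), (1 - 1 / (p : ℝ))| ≤
      1 / (z - 1) := by
  set S := (Nat.primesBelow ⌈w⌉₊).filter (fun p : ℕ => z ≤ (p : ℝ)) with hS
  have hmem : ∀ p ∈ S, (2 : ℝ) ≤ p := by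
    intro p hp; rw [hS, Finset.mem_filter] at hp; linarith [hp.2]
  have ha : ∀ p ∈ S, 0 ≤ 1 - 1 / ((p : ℝ) - 1) := by
    intro p hp; have := hmem p hp
    rw [sub_nonneg, div_le_one (by linarith)]; linarith
  have hab : ∀ p ∈ S, 1 - 1 / ((p : ℝ) - 1) ≤ 1 - 1 / (p : ℝ) := by
    intro p hp; have := hmem p hp
    have : 1 / (p : ℝ) ≤ 1 / ((p : ℝ) - 1) := one_div_le_one_div_of_le (by linarith) (by linarith)
    linarith
  have hb : ∀ p ∈ S, 1 - 1 / (p : ℝ) ≤ 1 := by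
    intro p hp; have := hmem p hp
    have : 0 ≤ 1 / (p : ℝ) := by positivity
    linarith
  have h1 := prod_sub_prod_le_sum S _ _ ha hab hb
  have h2 : ∏ p ∈ S, (1 - 1 / ((p : ℝ) - 1)) ≤ ∏ p ∈ S, (1 - 1 / (p : ℝ)) := Finset.prod_le_prod ha hab
  rw [abs_sub_comm, abs_of_nonneg (by linarith)]
  refine h1.trans ?_
  have e : ∑ p ∈ S, (1 - 1 / (p : ℝ) - (1 - 1 / ((p : ℝ) - 1))) =
      ∑ p ∈ S, (1 / ((p : ℝ) - 1) - 1 / (p : ℝ)) := Finset.sum_congr rfl fun p _ => by ring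
  rw [e]
  exact sum_primes_inv_sub_inv_le hz

/-! ### The per-`d` arithmetic -/

/-- The triangle inequality for one modulus `d`, over real variables. -/
theorem typeI_per_d_arith {Sa Nb xφ xd J V Vshw Vshz Vzw P1 P2 E Ra L C₁ Cb z y : ℝ}
    (hFLa : |Sa - xφ * Vshw| ≤ C₁ * xφ * Vshw * E + Ra)
    (hFLb : |Nb - J * (V * Vzw)| ≤ Cb * J * (V * Vzw) * E + L ^ 2)
    (hVshw : Vshw = Vshz * P2) (hVzw : Vzw = Vshz * P1)
    (hP1 : |P2 - P1| ≤ 2 / z) (hP10 : 0 ≤ P1) (hP11 : P1 ≤ 1) (hP20 : 0 ≤ P2)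
    (hVshz0 : 0 ≤ Vshz) (hVshz1 : Vshz ≤ 1)
    (hxφ0 : 0 ≤ xφ - xd) (hxφ1 : xφ - xd ≤ 6 * xd / y) (hxφ2 : xφ ≤ 2 * xd)
    (hJ : |J - xd| ≤ 1) (hV : 0 < V) (hxd : 0 ≤ xd)
    (hC₁ : 0 ≤ C₁) (hCb : 0 ≤ Cb) (hE : 0 ≤ E) (hz : 0 < z) (hy : 0 < y) :
    |Sa - Nb / V| ≤ xd * (2 * C₁ * Vshw * E + 4 / z + 6 / y + Cb * Vzw * E) +
      (Ra + 1 + Cb * Vzw * E + L ^ 2 / V) := by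
  have hVzw0 : 0 ≤ Vzw := by rw [hVzw]; positivity
  have hVshw0 : 0 ≤ Vshw := by rw [hVshw]; positivity
  -- third term
  have h3 : |J * Vzw - Nb / V| ≤ Cb * J * Vzw * E + L ^ 2 / V := by
    have e : J * Vzw - Nb / V = (1 / V) * (J * (V * Vzw) - Nb) := by field_simp
    rw [e, abs_mul, abs_of_pos (by positivity : 0 < 1 / V), ← abs_neg, neg_sub]
    calc 1 / V * |Nb - J * (V * Vzw)| ≤ 1 / V * (Cb * J * (V * Vzw) * E + L ^ 2) :=
          mul_le_mul_of_nonneg_left hFLb (by positivity)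
      _ = Cb * J * Vzw * E + L ^ 2 / V := by field_simp
  -- second term
  have h2 : |xφ * Vshw - J * Vzw| ≤ xφ * (2 / z) + (6 * xd / y + 1) := by
    rw [hVshw, hVzw]
    have e : xφ * (Vshz * P2) - J * (Vshz * P1) = Vshz * (xφ * (P2 - P1) + (xφ - J) * P1) := by ring
    rw [e, abs_mul, abs_of_nonneg hVshz0]
    have hxφ : 0 ≤ xφ := by linarith
    have hin : |xφ * (P2 - P1) + (xφ - J) * P1| ≤ xφ * (2 / z) + (6 * xd / y + 1) := by
      refine (abs_add_le _ _).trans (add_le_add ?_ ?_)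
      · rw [abs_mul, abs_of_nonneg hxφ]; exact mul_le_mul_of_nonneg_left hP1 hxφ
      · rw [abs_mul, abs_of_nonneg hP10]
        have hxJ : |xφ - J| ≤ 6 * xd / y + 1 := by
          have h := abs_le.1 hJ
          rw [abs_le]; constructor <;> linarith
        calc |xφ - J| * P1 ≤ (6 * xd / y + 1) * 1 := mul_le_mul hxJ hP11 hP10 (by positivity)
          _ = 6 * xd / y + 1 := mul_one _
    calc Vshz * |xφ * (P2 - P1) + (xφ - J) * P1| ≤ 1 * (xφ * (2 / z) + (6 * xd / y + 1)) :=
          mul_le_mul hVshz1 hin (abs_nonneg _) zero_le_one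
      _ = _ := one_mul _
  -- combine
  have htri : |Sa - Nb / V| ≤ |Sa - xφ * Vshw| + |xφ * Vshw - J * Vzw| + |J * Vzw - Nb / V| := by
    have e : Sa - Nb / V = (Sa - xφ * Vshw) + (xφ * Vshw - J * Vzw) + (J * Vzw - Nb / V) := by ring
    rw [e]
    exact (abs_add_le _ _).trans (add_le_add (abs_add_le _ _) le_rfl)
  have hJ1 : J ≤ xd + 1 := by have := (abs_le.1 hJ).2; linarith
  have hsum : C₁ * xφ * Vshw * E + Ra + (xφ * (2 / z) + (6 * xd / y + 1)) + (Cb * J * Vzw * E + L ^ 2 / V) ≤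
      xd * (2 * C₁ * Vshw * E + 4 / z + 6 / y + Cb * Vzw * E) + (Ra + 1 + Cb * Vzw * E + L ^ 2 / V) := by
    have t1 : C₁ * xφ * Vshw * E ≤ xd * (2 * C₁ * Vshw * E) := by
      have h := mul_le_mul_of_nonneg_left hxφ2 (by positivity : 0 ≤ C₁ * Vshw * E)
      have e1 : C₁ * Vshw * E * xφ = C₁ * xφ * Vshw * E := by ring
      have e2 : C₁ * Vshw * E * (2 * xd) = xd * (2 * C₁ * Vshw * E) := by ring
      linarith
    have t2 : xφ * (2 / z) ≤ xd * (4 / z) := by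
      have h := mul_le_mul_of_nonneg_right hxφ2 (by positivity : 0 ≤ 2 / z)
      have e : 2 * xd * (2 / z) = xd * (4 / z) := by ring
      linarith
    have t3 : Cb * J * Vzw * E ≤ xd * (Cb * Vzw * E) + Cb * Vzw * E := by
      have h := mul_le_mul_of_nonneg_left hJ1 (by positivity : 0 ≤ Cb * Vzw * E)
      have e1 : Cb * Vzw * E * J = Cb * J * Vzw * E := by ring
      have e2 : Cb * Vzw * E * (xd + 1) = xd * (Cb * Vzw * E) + Cb * Vzw * E := by ring
      linarith
    have t4 : 6 * xd / y = xd * (6 / y) := by ring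
    have e5 : xd * (2 * C₁ * Vshw * E + 4 / z + 6 / y + Cb * Vzw * E) =
        xd * (2 * C₁ * Vshw * E) + xd * (4 / z) + xd * (6 / y) + xd * (Cb * Vzw * E) := by ring
    linarith [t1, t2, t3, t4, e5]
  linarith [htri, hFLa, h2, h3, hsum]

end Summit.Parity.GeneralizedHardyLittlewood.Theorems.ParityLeakOneFifth
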